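import Summits.QuantumFields.BalabanUV.T4Continuum.Support.NE7EJTorusAlias
import Summits.QuantumFields.BalabanUV.T4Continuum.Support.NE7EJTorusMultiplier
import Summits.QuantumFields.BalabanUV.T4Continuum.Support.NE7EJFlatSecularB
import Summits.QuantumFields.BalabanUV.T4Continuum.Support.NE7EJWeightMenu

/-!
# NE7EJTorusAliasWeights — row NE7 (node U5), candidate route HOM, variant H1L-EJ, item EJ-1b′ (T1)–(T3′): the flat master inequality
# «4AᵀA ≤ g(K)» ON EVERY EVEN TORUS FOR EVERY ADMISSIBLE WEIGHT `g` — the admissible set is CONVEX and upward closed, it contains (hh)'s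
# `g_hh` (file 124) and THEOREM B's `g_B = 2(2+K)⁻¹`; THEOREM B at the plaquette level in resolvent words: `Σ_P (avgR F P)² ≤ 64·⟨F, G⟩`
# for the solution `G` of `(2 + K)G = 2F`

Lineage `b2b-balaban-t4-ne7-p2` (CRUX PROVER NE7 #2 = C-HOM°'s kernel hand), generation 82; file 130.  Imports 124 `NE7EJTorusAlias` (alias fibres,
`norm_sq_tau16_fibPt`, `omegaC_fibPt`, `sum_fibre_eq`, the real objects `lapR ∕ gKR ∕ avgR` and their casts), 129 `NE7EJTorusMultiplier` (`fK`, `form_fK`,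
`fK_resolvent(_unique)`, reality), 128 `NE7EJFlatSecularB` (`secularSB_le_one_trig`), 127 `NE7EJWeightMenu` (`gB`, `inv_gB_four_mul`, `psiA_le_psiB`).

SOURCE (lens 1 = `t4-ne7-idea-1`; gen 67 `DEFECT-VS-HESSIAN-NOTE.md` 9e7cf2b6f8adbc99 §1 (A2)–(A3): «EF^flat ≥ φ(Hess^flat) on phys ⇔ 4A†A ≤ g(−Δ_plaq) …
in each alias block 4A†A = |t⟩⟨t| is RANK ONE»; gen 73 `FLATPADE-NOTE.md` d2ccf99438315edd: THEOREM B «4A†A ≤ 2(2−Δ_plaq)⁻¹», (iii) LANDSCAPE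
«admissible weights h = 1∕g form a convex set; (hh) and B are distinct axis-saturating extreme directions, neither implies the other»; d = 2, L = 2
FLAT abelian toy — «never the NE7 estimate»).  File 124 typed «4AᵀA ≤ g_hh(K)» for the ONE polynomial weight of THEOREM (hh).  THIS FILE re-runs
124's two analytic steps (the per-fibre rank-one criterion and the coarse Plancherel assembly) for an ARBITRARY weight:
* §1 **`Admissible g`** := on every alias fibre `g(ω_n) > 0` and `Σ_n |t_n|²∕g(ω_n) ≤ 1` (file 118's criterion); `admissible_gFlat` ((hh), files 117–118),
  **`admissible_gB`** (THEOREM B, file 128: `Σ_n |t_n|²∕g_B(ω_n) = S_B = 1 − ¼sin²p₁sin²p₂ ≤ 1`), **`admissible_mono`** (weaker weights pass),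
  **`admissible_interp`** (CONVEXITY in `1∕g`: `(λ∕g₁ + (1−λ)∕g₂)⁻¹` is admissible), `admissible_gPade` (`1 − ψ_a`, `0 < a ≤ 4`, from B by 127).
* §2 **`fibre_ineq_of_admissible`** ∕ `fibre_sum_ineq_of_admissible` — 124's per-fibre and summed inequalities with `g_hh` replaced by `g`.
* §3 **`master_complex_of_admissible`**: `Σ_P ‖avgS F P‖² ≤ 64·Re⟨F, g(K)F⟩` for every complex plaquette field on `(ℤ∕2N)²`; the REAL operator
  `fKR g` (`= Re g(K)` on real fields; `fKR_cast`; `lapR_eq_fKR`, `gKR_eq_fKR` dock 124's position-space operators) and **`master_real_of_admissible`**: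
  `Σ_P (avgR F P)² ≤ 64·Σ_x F(x)(g(K)F)(x)`; monotonicity ∕ positivity of the real forms in the profile.
* §4 THEOREM B AT THE PLAQUETTE LEVEL: **`master_real_B`** (`g = g_B`), `resolvent_gB` (`2·g_B(K)F + K·g_B(K)F = 2F`), and the operator-free wording
  **`master_real_B_resolvent`**: for real plaquette fields `F, G` with `2G + KG = 2F` (i.e. `G = 2(2+K)⁻¹F`), `Σ_P (avgR F P)² ≤ 64·Σ_x F(x)G(x)`.
The 1-form level (`EF^flat ≥ ⟨dw, ψ(K)dw⟩`, THEOREM B as «EF^flat ≥ Hess²(2+Hess)⁻¹», COROLLARY B1 = (MI_a)^flat for `a ≤ 4`) is file 131.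

HONEST FRAMING: [folklore]; d = 2, L = 2 FLAT ABELIAN TOY RUNG of lens 1's («never the NE7 estimate») — even tori `(ℤ∕2N)²`; her objects stay hers;
nothing of Bałaban's instantiated beyond B7 (48)'s right side as file 122's definition (not used here); no d = 4 statement, no curved background,
nothing at ε > 0; NOT a letter move (PRICING-NE7 v56 §413: toy rungs at zero letter); T-50-10 honoured.  NE7 NOT PRINTED ∕ NOT PROVED; spine 0∕9;
FIXED FINITE T⁴, rung (B)+1; NOT infinite volume, NOT mass gap, NOT Clay.  HONEST DEPENDENCY: continuum YM on T⁴ ⇐ BetaPertH ∧ nine spine estimates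
(0/9 proved); BetaPertH ⇐ (D1) ∧ (D4) ∧ CAP+tail; G-an2-4 gates asym, D1 and NE2/3/4.
-/

noncomputable section

open Finset Complex ZMod

namespace Summit.QuantumFields.BalabanUV.T4Continuum.NE7EJTorusAliasWeights

open NE7EJTorusFourier NE7EJTorusAlias NE7EJTorusMultiplier NE7EJFlatSecular NE7EJSecularCriterion NE7EJFlatSecularB NE7EJWeightMenu

/-! ### §1 Admissible weights: the secular criterion, convexity, the two extreme instances -/

/-- **lens 1's secular criterion for a weight `g`** (file 118, per alias fibre): at every fine momentum `p = (p₁,p₂)`, `g(ω_n(p)) > 0` on the four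
aliases and `Σ_n |t_n(p)|²∕g(ω_n(p)) ≤ 1`. [folklore] -/
def Admissible (g : ℝ → ℝ) : Prop :=
  ∀ p₁ p₂ : ℝ, (∀ n : Alias, 0 < g (omegaA p₁ p₂ n)) ∧ ∑ n, tSq p₁ p₂ n / g (omegaA p₁ p₂ n) ≤ 1

/-- the alias symbol is non-negative. [folklore] -/
theorem omegaA_nonneg (p₁ p₂ : ℝ) (n : Alias) : 0 ≤ omegaA p₁ p₂ n := by unfold omegaA; positivity

/-- the alias symbol is at most `8`. [folklore] -/
theorem omegaA_le_eight (p₁ p₂ : ℝ) (n : Alias) : omegaA p₁ p₂ n ≤ 8 := by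
  unfold omegaA
  nlinarith [Real.sin_sq_le_one ((p₁ + if n.1 then Real.pi else 0) / 2), Real.sin_sq_le_one ((p₂ + if n.2 then Real.pi else 0) / 2)]

/-- **(hh) is admissible** (files 117–118: `Σ_n |t_n|²∕g_hh(ω_n) = S_φ ≤ 1`). [folklore] -/
theorem admissible_gFlat : Admissible gFlat := fun p₁ p₂ =>
  ⟨fun n => gFlat_pos _, by rw [block_secular_eq]; exact secularS_le_one_trig p₁ p₂⟩

/-- THEOREM B's block sum IS file 128's `S_B`: `Σ_n |t_n|²∕g_B(ω_n) = S_B(sin²(p₁∕2), sin²(p₂∕2))`. [folklore] -/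
theorem block_secularB_eq (p₁ p₂ : ℝ) :
    ∑ n, tSq p₁ p₂ n / gB (omegaA p₁ p₂ n) = secularSB (Real.sin (p₁ / 2) ^ 2) (Real.sin (p₂ / 2) ^ 2) := by
  unfold secularSB
  refine sum_congr rfl fun n _ => ?_
  rw [tSq_eq_ww, omegaA_eq_four_uu, div_eq_mul_inv,
    inv_gB_four_mul (uu_mem (sin_sq_half_mem p₁) (sin_sq_half_mem p₂) n).1]

/-- **THEOREM B is admissible**: `g_B = 2∕(2+ω)` passes the criterion, `Σ_n |t_n|²∕g_B(ω_n) = 1 − ¼sin²p₁sin²p₂ ≤ 1`. [folklore] -/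
theorem admissible_gB : Admissible gB := fun p₁ p₂ =>
  ⟨fun n => gB_pos (by linarith [omegaA_nonneg p₁ p₂ n]), by rw [block_secularB_eq]; exact secularSB_le_one_trig p₁ p₂⟩

/-- **upward closure**: a weight dominating an admissible one on `[0,8]` is admissible. [folklore] -/
theorem admissible_mono {g g' : ℝ → ℝ} (hg : Admissible g) (hle : ∀ x, 0 ≤ x → x ≤ 8 → g x ≤ g' x) : Admissible g' := by
  intro p₁ p₂
  obtain ⟨hpos, hS⟩ := hg p₁ p₂
  have hle' : ∀ n : Alias, g (omegaA p₁ p₂ n) ≤ g' (omegaA p₁ p₂ n) := fun n => hle _ (omegaA_nonneg p₁ p₂ n) (omegaA_le_eight p₁ p₂ n)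
  refine ⟨fun n => lt_of_lt_of_le (hpos n) (hle' n), le_trans (sum_le_sum fun n _ => ?_) hS⟩
  exact div_le_div_of_nonneg_left (tSq_nonneg p₁ p₂ n) (hpos n) (hle' n)

/-- **CONVEXITY** (lens 1 gen 73 (iii): «admissible weights h = 1∕g form a convex set»): for admissible `g₁, g₂` and `λ ∈ [0,1]`, the weight with
inverse `λ∕g₁ + (1−λ)∕g₂` is admissible. [folklore] -/
theorem admissible_interp {g₁ g₂ : ℝ → ℝ} (h₁ : Admissible g₁) (h₂ : Admissible g₂) {t : ℝ} (ht0 : 0 ≤ t) (ht1 : t ≤ 1) :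
    Admissible (fun x => (t / g₁ x + (1 - t) / g₂ x)⁻¹) := by
  intro p₁ p₂
  obtain ⟨hpos₁, hS₁⟩ := h₁ p₁ p₂
  obtain ⟨hpos₂, hS₂⟩ := h₂ p₁ p₂
  have hcomb : ∀ n : Alias, 0 < t / g₁ (omegaA p₁ p₂ n) + (1 - t) / g₂ (omegaA p₁ p₂ n) := by
    intro n
    rcases lt_or_ge t 1 with h | h
    · exact add_pos_of_nonneg_of_pos (div_nonneg ht0 (hpos₁ n).le) (div_pos (by linarith) (hpos₂ n))
    · have ht : t = 1 := le_antisymm ht1 h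
      rw [ht]; simp only [sub_self, zero_div, add_zero]; exact div_pos one_pos (hpos₁ n)
  refine ⟨fun n => inv_pos.mpr (hcomb n), ?_⟩
  have e : ∀ n : Alias, tSq p₁ p₂ n / (t / g₁ (omegaA p₁ p₂ n) + (1 - t) / g₂ (omegaA p₁ p₂ n))⁻¹
      = t * (tSq p₁ p₂ n / g₁ (omegaA p₁ p₂ n)) + (1 - t) * (tSq p₁ p₂ n / g₂ (omegaA p₁ p₂ n)) := fun n => by
    rw [div_inv_eq_mul]; ring
  simp_rw [e]
  rw [sum_add_distrib, ← mul_sum, ← mul_sum]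
  nlinarith [mul_le_mul_of_nonneg_left hS₁ ht0, mul_le_mul_of_nonneg_left hS₂ (by linarith : (0:ℝ) ≤ 1 - t)]

/-- `g_B = 1 − ψ_B` on `x ≥ 0` (file 127). [folklore] -/
theorem gB_eq_on_nonneg {x : ℝ} (hx : 0 ≤ x) : gB x = 1 - psiB x := gB_eq_one_sub_psiB (by linarith)

/-- **the Padé weights `1 − ψ_a` are admissible for `0 < a ≤ 4`** (COROLLARY B1's admissibility: `1 − ψ_a ≥ 1 − ψ_B = g_B` on `[0,8]`, file 127
`psiA_le_psiB`). [folklore] -/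
theorem admissible_gPade {a : ℝ} (ha : 0 < a) (ha4 : a ≤ 4) : Admissible (fun x => 1 - psiA a x) :=
  admissible_mono admissible_gB fun x hx _ => by rw [gB_eq_on_nonneg hx]; linarith [psiA_le_psiB ha ha4 hx]

/-! ### §2 The per-fibre inequality for an admissible weight (file 124 §2 with `g_hh ↦ g`) -/

section Fibre

variable (N : ℕ) [NeZero N]

/-- the real symbol on a fibre point: `ω(p_n(c)) = omegaA(θ(c), n)`. [folklore] -/
theorem omegaR_fibPt (c : XX N) (n : Bool × Bool) : omegaR (fibPt N c n) = omegaA (angB N c.1) (angB N c.2) n := by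
  have h := omegaC_fibPt N c n
  rw [omegaC_eq_omegaR] at h
  exact_mod_cast h

/-- **THE PER-FIBRE INEQUALITY for an admissible weight**: `‖Σ_n F̂(p_n)τ₁₆(p_n)‖² ≤ 256·Σ_n g(ω(p_n))‖F̂(p_n)‖²`. [folklore] -/
theorem fibre_ineq_of_admissible {g : ℝ → ℝ} (hg : Admissible g) (F : XX (2 * N) → ℂ) (c : XX N) :
    ‖∑ n : Bool × Bool, fhat F (fibPt N c n) * tau16 N (fibPt N c n)‖ ^ 2
      ≤ 256 * ∑ n : Bool × Bool, g (omegaA (angB N c.1) (angB N c.2) n) * ‖fhat F (fibPt N c n)‖ ^ 2 := by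
  have ht : ∀ n : Bool × Bool, ‖starRingEnd ℂ (tau16 N (fibPt N c n)) / 16‖ ^ 2 = tSq (angB N c.1) (angB N c.2) n := by
    intro n; rw [norm_div, Complex.norm_conj, div_pow, norm_sq_tau16_fibPt]; norm_num
  obtain ⟨hpos, hS⟩ := hg (angB N c.1) (angB N c.2)
  have hS' : ∑ n : Bool × Bool, ‖starRingEnd ℂ (tau16 N (fibPt N c n)) / 16‖ ^ 2 / g (omegaA (angB N c.1) (angB N c.2) n) ≤ 1 := by
    simp only [ht]; exact hS
  have h := (rankOne_le_diag_iff_complex hpos _).mpr hS' (fun n => fhat F (fibPt N c n))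
  have e : ∑ n : Bool × Bool, starRingEnd ℂ (starRingEnd ℂ (tau16 N (fibPt N c n)) / 16) * fhat F (fibPt N c n)
      = (∑ n : Bool × Bool, fhat F (fibPt N c n) * tau16 N (fibPt N c n)) / 16 := by
    rw [Finset.sum_div]
    refine sum_congr rfl fun n _ => ?_
    rw [map_div₀, Complex.conj_conj, map_ofNat]; ring
  rw [e, norm_div, div_pow] at h
  have h16 : ‖(16 : ℂ)‖ ^ 2 = 256 := by simp; norm_num
  rw [h16, div_le_iff₀ (by norm_num : (0:ℝ) < 256)] at h
  linarith

/-- **summed over the fibres**: `Σ_c ‖Σ_{p ∈ fib c} F̂(p)τ₁₆(p)‖² ≤ 256·Σ_p g(ω(p))‖F̂(p)‖²`. [folklore] -/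
theorem fibre_sum_ineq_of_admissible {g : ℝ → ℝ} (hg : Admissible g) (F : XX (2 * N) → ℂ) :
    ∑ c : XX N, ‖∑ p ∈ univ.filter (fun p => red2 N p = c), fhat F p * tau16 N p‖ ^ 2
      ≤ 256 * ∑ p, g (omegaR p) * ‖fhat F p‖ ^ 2 := by
  rw [← sum_fiberwise univ (red2 N) (fun p => g (omegaR p) * ‖fhat F p‖ ^ 2), mul_sum]
  refine sum_le_sum fun c _ => ?_
  rw [sum_fibre_eq N c, sum_fibre_eq_real N c]
  refine (fibre_ineq_of_admissible N hg F c).trans (le_of_eq ?_)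
  congr 1
  exact sum_congr rfl fun n _ => by rw [omegaR_fibPt]

end Fibre

/-! ### §3 The master inequality «4AᵀA ≤ g(K)» on every even torus, every admissible weight -/

section Master

variable (N : ℕ) [NeZero N]

/-- **`4AᵀA ≤ g(K)` ON EVERY EVEN TORUS, EVERY ADMISSIBLE `g`, complex form**: `Σ_P ‖avgS F P‖² ≤ 64·Re Σ_x conj(F x)·(g(K)F)(x)`. [folklore] -/
theorem master_complex_of_admissible {g : ℝ → ℝ} (hg : Admissible g) (F : XX (2 * N) → ℂ) :
    ∑ P : Fin N × Fin N, ‖avgS N F P‖ ^ 2 ≤ 64 * (∑ x, starRingEnd ℂ (F x) * fK g F x).re := by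
  have hN : (0 : ℝ) < N := by exact_mod_cast Nat.pos_of_ne_zero (NeZero.ne N)
  have h1 : ∀ P, ‖avgS N F P‖ ^ 2 * (2 * (N : ℝ)) ^ 4 = ‖∑ p, (fhat F p * tau16 N p) * chi p (corner N P)‖ ^ 2 := by
    intro P
    rw [← avgS_fourier, norm_mul, mul_pow, norm_pow, Complex.norm_natCast]; push_cast; ring
  have h2 := sum_corner_normSq N (fun p => fhat F p * tau16 N p)
  have h3 := fibre_sum_ineq_of_admissible N hg F
  have h4 : ∑ p, g (omegaR p) * ‖fhat F p‖ ^ 2 = (2 * (N : ℝ)) ^ 2 * (∑ x, starRingEnd ℂ (F x) * fK g F x).re := by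
    rw [← form_fK]; push_cast; ring
  have hsum : (∑ P : Fin N × Fin N, ‖avgS N F P‖ ^ 2) * (2 * (N : ℝ)) ^ 4
      ≤ (N : ℝ) ^ 2 * (256 * ((2 * (N : ℝ)) ^ 2 * (∑ x, starRingEnd ℂ (F x) * fK g F x).re)) := by
    rw [sum_mul]
    simp_rw [h1]
    rw [h2, ← h4]
    exact mul_le_mul_of_nonneg_left h3 (by positivity)
  have hpos : (0 : ℝ) < (2 * (N : ℝ)) ^ 4 := by positivity
  have key : (∑ P : Fin N × Fin N, ‖avgS N F P‖ ^ 2) * (2 * (N : ℝ)) ^ 4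
      ≤ (64 * (∑ x, starRingEnd ℂ (F x) * fK g F x).re) * (2 * (N : ℝ)) ^ 4 := by
    calc _ ≤ (N : ℝ) ^ 2 * (256 * ((2 * (N : ℝ)) ^ 2 * (∑ x, starRingEnd ℂ (F x) * fK g F x).re)) := hsum
      _ = (64 * (∑ x, starRingEnd ℂ (F x) * fK g F x).re) * (2 * (N : ℝ)) ^ 4 := by ring
  exact le_of_mul_le_mul_right key hpos

end Master

/-! ### The real operator `g(K)` on real plaquette fields and the real master inequality -/

section RealOps

variable {M : ℕ} [NeZero M]

/-- **the real operator `g(K)`** on real fields: `fKR g F := Re g(K)(↑F)` (the imaginary part vanishes, file 129 `fK_im_eq_zero`). [folklore] -/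
def fKR (g : ℝ → ℝ) (F : XX M → ℝ) (x : XX M) : ℝ := (fK g (fun y => ((F y : ℝ) : ℂ)) x).re

/-- casting: `↑(fKR g F x) = g(K)(↑F)(x)`. [folklore] -/
theorem fKR_cast (g : ℝ → ℝ) (F : XX M → ℝ) (x : XX M) : ((fKR g F x : ℝ) : ℂ) = fK g (fun y => ((F y : ℝ) : ℂ)) x :=
  (fK_eq_ofReal_re g F x).symm

/-- the real form is the real part of the complex one: `Σ_x F(x)(g(K)F)(x) = Re Σ_x conj(↑F x)·g(K)(↑F)(x)`. [folklore] -/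
theorem sum_mul_fKR (g : ℝ → ℝ) (F : XX M → ℝ) :
    ∑ x, F x * fKR g F x = (∑ x, starRingEnd ℂ ((F x : ℝ) : ℂ) * fK g (fun y => ((F y : ℝ) : ℂ)) x).re := by
  simp_rw [← fKR_cast, Complex.conj_ofReal, ← Complex.ofReal_mul]
  rw [← Complex.ofReal_sum, Complex.ofReal_re]

/-- **Parseval, real form**: `M²·Σ_x F(x)(g(K)F)(x) = Σ_p g(ω(p))‖(↑F)^(p)‖²`. [folklore] -/
theorem form_fKR (g : ℝ → ℝ) (F : XX M → ℝ) :
    ((M : ℝ) ^ 2) * ∑ x, F x * fKR g F x = ∑ p, g (omegaR p) * ‖fhat (fun y => ((F y : ℝ) : ℂ)) p‖ ^ 2 := by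
  rw [sum_mul_fKR, form_fK]

/-- monotonicity of the real form in the profile on `[0,8]`. [folklore] -/
theorem form_fKR_mono {g g' : ℝ → ℝ} (hle : ∀ x, 0 ≤ x → x ≤ 8 → g x ≤ g' x) (F : XX M → ℝ) :
    ∑ x, F x * fKR g F x ≤ ∑ x, F x * fKR g' F x := by
  rw [sum_mul_fKR, sum_mul_fKR]; exact form_fK_mono hle _

/-- positivity of the real form for a profile non-negative on `[0,8]`. [folklore] -/
theorem form_fKR_nonneg {g : ℝ → ℝ} (hnn : ∀ x, 0 ≤ x → x ≤ 8 → 0 ≤ g x) (F : XX M → ℝ) : 0 ≤ ∑ x, F x * fKR g F x := by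
  rw [sum_mul_fKR]; exact form_fK_nonneg hnn _

/-- only the profile on `[0,8]` matters. [folklore] -/
theorem fKR_congr {g g' : ℝ → ℝ} (heq : ∀ x, 0 ≤ x → x ≤ 8 → g x = g' x) (F : XX M → ℝ) : fKR g F = fKR g' F := by
  funext x; unfold fKR; rw [fK_congr heq]

/-- `(g − g′)(K) = g(K) − g′(K)` on real fields. [folklore] -/
theorem fKR_sub (g g' : ℝ → ℝ) (F : XX M → ℝ) (x : XX M) : fKR (fun t => g t - g' t) F x = fKR g F x - fKR g' F x := by
  unfold fKR; rw [fK_sub]; simp only [Complex.sub_re]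

/-- `1(K) = id` on real fields. [folklore] -/
theorem fKR_one (F : XX M → ℝ) (x : XX M) : fKR (fun _ => 1) F x = F x := by
  unfold fKR; rw [fK_one, Complex.ofReal_re]

/-- `(c·g)(K) = c·g(K)` on real fields. [folklore] -/
theorem fKR_smul (c : ℝ) (g : ℝ → ℝ) (F : XX M → ℝ) (x : XX M) : fKR (fun t => c * g t) F x = c * fKR g F x := by
  unfold fKR; rw [fK_smul]; simp only [Complex.re_ofReal_mul]

end RealOps

section RealMaster

variable (N : ℕ) [NeZero N]

/-- docking: file 124's real Laplacian IS `id(K)` — `lapR F = fKR id F`. [folklore] -/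
theorem lapR_eq_fKR (F : XX (2 * N) → ℝ) (x : XX (2 * N)) : lapR N F x = fKR (fun t => t) F x := by
  have h : ((lapR N F x : ℝ) : ℂ) = ((fKR (fun t => t) F x : ℝ) : ℂ) := by
    rw [lapR_cast, fKR_cast, fK_id]
  exact_mod_cast h

/-- docking: file 124's `gKR = F − ½KF + ⅛K²F` IS `g_hh(K)` — `gKR F = fKR gFlat F`. [folklore] -/
theorem gKR_eq_fKR (F : XX (2 * N) → ℝ) (x : XX (2 * N)) : gKR N F x = fKR gFlat F x := by
  have h : ((gKR N F x : ℝ) : ℂ) = ((fKR gFlat F x : ℝ) : ℂ) := by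
    rw [gKR_cast, fKR_cast, gK_eq_fK]
    exact congrFun (fK_congr (fun t _ _ => by unfold gFlat; ring) _) x
  exact_mod_cast h

/-- **`4AᵀA ≤ g(K)` ON EVERY EVEN TORUS, EVERY ADMISSIBLE `g`, REAL FORM**: `Σ_P (avgR F P)² ≤ 64·Σ_x F(x)·(g(K)F)(x)` for every real plaquette field
on `(ℤ∕2N)²` (`avgR = 16·AF`). [folklore] -/
theorem master_real_of_admissible {g : ℝ → ℝ} (hg : Admissible g) (F : XX (2 * N) → ℝ) :
    ∑ P : Fin N × Fin N, avgR N F P ^ 2 ≤ 64 * ∑ x, F x * fKR g F x := by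
  have h := master_complex_of_admissible N hg (fun y => (F y : ℂ))
  have e1 : ∀ P, ‖avgS N (fun y => (F y : ℂ)) P‖ ^ 2 = avgR N F P ^ 2 := fun P => by
    rw [← avgR_cast, Complex.norm_real, Real.norm_eq_abs, sq_abs]
  simp_rw [e1] at h
  rwa [← sum_mul_fKR] at h

/-- consistency: file 124's `master_real` is the instance `g = g_hh`. [folklore] -/
theorem master_real_gFlat (F : XX (2 * N) → ℝ) : ∑ P : Fin N × Fin N, avgR N F P ^ 2 ≤ 64 * ∑ x, F x * gKR N F x := by
  simp_rw [gKR_eq_fKR]; exact master_real_of_admissible N admissible_gFlat F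

/-! ### §4 THEOREM B at the plaquette level: `4AᵀA ≤ 2(2 + K)⁻¹` -/

/-- **THEOREM B, plaquette level**: `Σ_P (avgR F P)² ≤ 64·Σ_x F(x)·(g_B(K)F)(x)` with `g_B(K) = 2(2+K)⁻¹`. [folklore] -/
theorem master_real_B (F : XX (2 * N) → ℝ) : ∑ P : Fin N × Fin N, avgR N F P ^ 2 ≤ 64 * ∑ x, F x * fKR gB F x :=
  master_real_of_admissible N admissible_gB F

/-- `g_B` IS the resolvent profile `r_2` of file 129. [folklore] -/
theorem gB_eq_resProfile : gB = resProfile 2 := funext fun _ => rfl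

/-- **the resolvent identity for `g_B(K)` on real fields**: `2·(g_B(K)F) + K(g_B(K)F) = 2F`. [folklore] -/
theorem resolvent_gB (F : XX (2 * N) → ℝ) (x : XX (2 * N)) : 2 * fKR gB F x + lapR N (fKR gB F) x = 2 * F x := by
  have h := congrFun (fK_resolvent (M := 2 * N) (c := 2) two_pos (fun y => (F y : ℂ))) x
  have hc : (fun y => ((fKR gB F y : ℝ) : ℂ)) = fK (resProfile 2) (fun y => ((F y : ℝ) : ℂ)) := by
    funext y; rw [fKR_cast, gB_eq_resProfile]
  have e : (((2 * fKR gB F x + lapR N (fKR gB F) x : ℝ)) : ℂ) = (((2 * F x : ℝ)) : ℂ) := by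
    simp only [Complex.ofReal_add, Complex.ofReal_mul]
    rw [lapR_cast, hc, fKR_cast, gB_eq_resProfile]
    exact h
  exact Complex.ofReal_injective e

/-- uniqueness: a real solution `G` of `2G + KG = 2F` IS `g_B(K)F`. [folklore] -/
theorem eq_fKR_gB_of_resolvent {F G : XX (2 * N) → ℝ} (hG : ∀ x, 2 * G x + lapR N G x = 2 * F x) : G = fKR gB F := by
  have hGc : ∀ x, (2 : ℝ) * ((G x : ℝ) : ℂ) + lapP (fun y => ((G y : ℝ) : ℂ)) x = ((2 : ℝ) : ℂ) * ((F x : ℝ) : ℂ) := by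
    intro x
    have := hG x
    rw [← lapR_cast]
    exact_mod_cast this
  have h := fK_resolvent_unique (M := 2 * N) (c := 2) two_pos hGc
  funext x
  have hx := congrFun h x
  rw [← gB_eq_resProfile, ← fKR_cast] at hx
  exact_mod_cast hx

/-- **THEOREM B, OPERATOR-FREE WORDING**: for real plaquette fields `F, G` on `(ℤ∕2N)²` with `(2 + K)G = 2F` — i.e. `G = 2(2 − Δ_plaq)⁻¹F` —
`Σ_P (avgR F P)² ≤ 64·Σ_x F(x)G(x)`: lens 1's «4A†A ≤ 2(2−Δ_plaq)⁻¹» on every even torus. [folklore] -/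
theorem master_real_B_resolvent (F G : XX (2 * N) → ℝ) (hG : ∀ x, 2 * G x + lapR N G x = 2 * F x) :
    ∑ P : Fin N × Fin N, avgR N F P ^ 2 ≤ 64 * ∑ x, F x * G x := by
  rw [eq_fKR_gB_of_resolvent N hG]; exact master_real_B N F

/-- the interpolated weights between (hh) and B are admissible (convexity instance). [folklore] -/
theorem admissible_hh_B_interp {t : ℝ} (ht0 : 0 ≤ t) (ht1 : t ≤ 1) : Admissible (fun x => (t / gFlat x + (1 - t) / gB x)⁻¹) :=
  admissible_interp admissible_gFlat admissible_gB ht0 ht1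

end RealMaster

end Summit.QuantumFields.BalabanUV.T4Continuum.NE7EJTorusAliasWeights

end
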